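import Summits.Ventures.GridStability.Models.InverterDVOCQuotient3

/-!
# GridStability/Models/InverterDVOCQuotientN — the dVOC quotient dynamics closes at degree 2 for EVERY `N` (kernel proof of the general closed form)

Cell `gridfusion` (LADDER-GRIDFUSION, APEX LINE rung G3.c; lead «T3′ FORM», RULING 18 «operator size»);
seat gridfusion-model-3 (g3). Companion of `InverterDVOCQuotient.lean` (p467971, `N = 2`),
`InverterDVOCQuotient3.lean` (p480883, `N = 3` by `ring` + the general-`N` blocks `netA/netB/ctlP/ctlQ`
and product rules), and model-4's general identity note in `instance-N3-9bus-quot.json`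
(«dS_kj/dt = η[(conj g_k + g_j + α(Φ_k + Φ_j)) S_kj − Σ_m conj(y′_km) S_mj − Σ_m y′_jm S_km]»,
`S_kj = ξ_kj + iζ_kj`). THREE COLUMNS: MODELLED column — exact algebra on the typed reduced dVOC
network `InverterDVOC.DvocNetwork N` (p465594, [cite: SuboticEtAl2021, eq. (ss.f.vhat)]) for
ARBITRARY `N` and ARBITRARY admittance blocks (shunts admissible); no certificate, no stability claim.

## What is proved (general `N`, no `Fin.sum_univ_*` unrolling)

With `P_k, Q_k` (`ctlP`, `ctlQ`), `A_kj, B_kj` (`netA`, `netB`), `Φ_k = 1 − ρ_k/v_k*²` and the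
invariants `ρ_k = ξ_kk`, `ξ_kj = ⟨v̂_k, v̂_j⟩`, `ζ_kj = v̂_k ∧ v̂_j`:
* `inner_dv`  : `⟨v̂̇_k, v̂_j⟩ = η[(P_k + η_aΦ_k) ξ_kj + Q_k ζ_kj − Σ_i (A_ki ξ_ij + B_ki ζ_ij)]`;
* `innerJ_dv` : `⟨J v̂̇_k, v̂_j⟩ = η[(P_k + η_aΦ_k) ζ_kj − Q_k ξ_kj − Σ_i (A_ki ζ_ij − B_ki ξ_ij)]`;
* hence the LIE DERIVATIVES of all invariants are polynomials of degree 2 in the invariants: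
  `lie_rho_eq` (`ρ̇_k = 2⟨v̂̇_k, v̂_k⟩`), `lie_xi_eq` (`ξ̇_kj = ⟨v̂̇_k, v̂_j⟩ + ⟨v̂̇_j, v̂_k⟩`),
  `lie_zeta_eq` (`ζ̇_kj = ⟨Jv̂̇_k, v̂_j⟩ − ⟨Jv̂̇_j, v̂_k⟩`), with `ξ_jk = ξ_kj`, `ζ_jk = −ζ_kj`
  (`xi_comm`, `zeta_anticomm`) to reach the symmetrised closed form of the `Quotient3` header;
* along solutions (`hasDerivWithinAt_rho_eq/xi_eq/zeta_eq`): the invariant coordinates of every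
  network solution obey these quotient equations within any time set.
So for every `N` the orbit space of the rotation-equivariant model carries a POLYNOMIAL vector field of
degree 2 in the `N²` invariants (variety cut out by the rank-one syzygies of `v̂v̂*`); an instance file
for a new `N` only has to list coefficients (as `InverterDVOCInstance9bus.lean` did) — no new Lie
identity is ever needed. COST note (memo §5): dense Gram at `V` quadratic in the invariants is
`C(N² + 2, 2)` (N = 4: 171, N = 10: 5151) ⇒ beyond `N = 3` the quotient route needs the same sparsity
levers as the network frame; Track T (GrossEtAl2019 Prop. 3, `InverterDVOCReducedBridge`) stays the
size-independent lane. MODELLED: MV-6O. No sentence here says a converter or a grid is stable.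
-/

noncomputable section

open Real Finset

namespace Summit.Ventures.GridStability.Models.InverterDVOC.DvocNetwork

variable {N : ℕ} (W : DvocNetwork N)

/-! ## §1 Symmetries of the invariants -/

/-- `ξ_jk = ξ_kj`. -/
theorem xi_comm (v : State N) (k j : Fin N) : xi v j k = xi v k j := by
  simp only [xi]; ring

/-- `ζ_jk = −ζ_kj`. -/
theorem zeta_anticomm (v : State N) (k j : Fin N) : zeta v j k = -zeta v k j := by
  simp only [zeta]; ring

/-- `ξ_kk = ρ_k`. -/
theorem xi_self (v : State N) (k : Fin N) : xi v k k = rho v k := by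
  simp only [xi, rho]; ring

/-- `ζ_kk = 0`. -/
theorem zeta_self (v : State N) (k : Fin N) : zeta v k k = 0 := by
  simp only [zeta]; ring

/-! ## §2 The four pairings of the field's building blocks with `v̂_j` -/

/-- Controller block: `⟨K_k v̂_k, v̂_j⟩ = P_k ξ_kj + Q_k ζ_kj` (with `K_k = P_k I₂ + Q_k J`). -/
theorem inner_Kv (v : State N) (k j : Fin N) :
    v.1 j * (W.unit k).Kv₁ (v.1 k) (v.2 k) + v.2 j * (W.unit k).Kv₂ (v.1 k) (v.2 k)
      = W.ctlP k * xi v k j + W.ctlQ k * zeta v k j := by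
  simp only [Dvoc.Kv₁, Dvoc.Kv₂, unit, ctlP, ctlQ, xi, zeta]
  ring

/-- Controller block through `J`: `⟨J K_k v̂_k, v̂_j⟩ = P_k ζ_kj − Q_k ξ_kj`. -/
theorem innerJ_Kv (v : State N) (k j : Fin N) :
    -(v.1 j * (W.unit k).Kv₂ (v.1 k) (v.2 k)) + v.2 j * (W.unit k).Kv₁ (v.1 k) (v.2 k)
      = W.ctlP k * zeta v k j - W.ctlQ k * xi v k j := by
  simp only [Dvoc.Kv₁, Dvoc.Kv₂, unit, ctlP, ctlQ, xi, zeta]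
  ring

/-- Network block: `⟨ℛ(κ)(𝒴v̂)_k, v̂_j⟩ = Σ_i (A_ki ξ_ij + B_ki ζ_ij)` — the ONE place where the
admittance sum is re-indexed into invariants (arbitrary `Yre`, `Yim`). -/
theorem inner_rotNetCur (v : State N) (k j : Fin N) :
    v.1 j * (cos W.κ * W.netCur₁ v k - sin W.κ * W.netCur₂ v k)
      + v.2 j * (sin W.κ * W.netCur₁ v k + cos W.κ * W.netCur₂ v k)
      = ∑ i, (W.netA k i * xi v i j + W.netB k i * zeta v i j) := by
  have h : v.1 j * (cos W.κ * W.netCur₁ v k - sin W.κ * W.netCur₂ v k)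
      + v.2 j * (sin W.κ * W.netCur₁ v k + cos W.κ * W.netCur₂ v k)
      = (v.1 j * cos W.κ + v.2 j * sin W.κ) * W.netCur₁ v k
        + (v.2 j * cos W.κ - v.1 j * sin W.κ) * W.netCur₂ v k := by ring
  rw [h, netCur₁, netCur₂, Finset.mul_sum, Finset.mul_sum, ← Finset.sum_add_distrib]
  refine Finset.sum_congr rfl fun i _ => ?_
  simp only [netA, netB, xi, zeta]
  ring

/-- Network block through `J`: `⟨J ℛ(κ)(𝒴v̂)_k, v̂_j⟩ = Σ_i (A_ki ζ_ij − B_ki ξ_ij)`. -/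
theorem innerJ_rotNetCur (v : State N) (k j : Fin N) :
    -(v.1 j * (sin W.κ * W.netCur₁ v k + cos W.κ * W.netCur₂ v k))
      + v.2 j * (cos W.κ * W.netCur₁ v k - sin W.κ * W.netCur₂ v k)
      = ∑ i, (W.netA k i * zeta v i j - W.netB k i * xi v i j) := by
  have h : -(v.1 j * (sin W.κ * W.netCur₁ v k + cos W.κ * W.netCur₂ v k))
      + v.2 j * (cos W.κ * W.netCur₁ v k - sin W.κ * W.netCur₂ v k)
      = (v.2 j * cos W.κ - v.1 j * sin W.κ) * W.netCur₁ v k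
        + (-(v.1 j * cos W.κ) - v.2 j * sin W.κ) * W.netCur₂ v k := by ring
  rw [h, netCur₁, netCur₂, Finset.mul_sum, Finset.mul_sum, ← Finset.sum_add_distrib]
  refine Finset.sum_congr rfl fun i _ => ?_
  simp only [netA, netB, xi, zeta]
  ring

/-! ## §3 `⟨v̂̇_k, v̂_j⟩` and `⟨J v̂̇_k, v̂_j⟩` in the invariants (general `N`) -/

/-- **`⟨v̂̇_k, v̂_j⟩` in the invariants**:
`x_j (f^s)_{k,1} + y_j (f^s)_{k,2} = η[(P_k + η_aΦ_k) ξ_kj + Q_k ζ_kj − Σ_i (A_ki ξ_ij + B_ki ζ_ij)]`.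
MODELLED: MV-6O. [cite: SuboticEtAl2021, eq. (ss.f.vhat)] -/
theorem inner_dv (v : State N) (k j : Fin N) :
    v.1 j * W.dv₁ v k + v.2 j * W.dv₂ v k
      = W.η * ((W.ctlP k + W.ηa * (1 - rho v k / W.vref k ^ 2)) * xi v k j + W.ctlQ k * zeta v k j
          - ∑ i, (W.netA k i * xi v i j + W.netB k i * zeta v i j)) := by
  have hK := W.inner_Kv v k j
  have hN := W.inner_rotNetCur v k j
  have hφ : (W.unit k).phi (v.1 k) (v.2 k) = 1 - rho v k / W.vref k ^ 2 := by
    simp only [Dvoc.phi, unit, rho]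
  have e : v.1 j * W.dv₁ v k + v.2 j * W.dv₂ v k
      = W.η * ((v.1 j * (W.unit k).Kv₁ (v.1 k) (v.2 k) + v.2 j * (W.unit k).Kv₂ (v.1 k) (v.2 k))
        + W.ηa * (W.unit k).phi (v.1 k) (v.2 k) * (v.1 k * v.1 j + v.2 k * v.2 j)
        - (v.1 j * (cos W.κ * W.netCur₁ v k - sin W.κ * W.netCur₂ v k)
          + v.2 j * (sin W.κ * W.netCur₁ v k + cos W.κ * W.netCur₂ v k))) := by
    simp only [dv₁, dv₂, Dvoc.dv₁, Dvoc.dv₂]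
    simp only [show (W.unit k).η = W.η from rfl, show (W.unit k).ηa = W.ηa from rfl,
      show (W.unit k).κ = W.κ from rfl]
    ring
  rw [e, hK, hN, hφ]
  simp only [xi]
  ring

/-- **`⟨J v̂̇_k, v̂_j⟩` in the invariants**:
`−x_j (f^s)_{k,2} + y_j (f^s)_{k,1} = η[(P_k + η_aΦ_k) ζ_kj − Q_k ξ_kj − Σ_i (A_ki ζ_ij − B_ki ξ_ij)]`.
MODELLED: MV-6O. [cite: SuboticEtAl2021, eq. (ss.f.vhat)] -/
theorem innerJ_dv (v : State N) (k j : Fin N) :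
    -(v.1 j * W.dv₂ v k) + v.2 j * W.dv₁ v k
      = W.η * ((W.ctlP k + W.ηa * (1 - rho v k / W.vref k ^ 2)) * zeta v k j - W.ctlQ k * xi v k j
          - ∑ i, (W.netA k i * zeta v i j - W.netB k i * xi v i j)) := by
  have hK := W.innerJ_Kv v k j
  have hN := W.innerJ_rotNetCur v k j
  have hφ : (W.unit k).phi (v.1 k) (v.2 k) = 1 - rho v k / W.vref k ^ 2 := by
    simp only [Dvoc.phi, unit, rho]
  have e : -(v.1 j * W.dv₂ v k) + v.2 j * W.dv₁ v k
      = W.η * ((-(v.1 j * (W.unit k).Kv₂ (v.1 k) (v.2 k)) + v.2 j * (W.unit k).Kv₁ (v.1 k) (v.2 k))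
        + W.ηa * (W.unit k).phi (v.1 k) (v.2 k) * (v.1 k * v.2 j - v.2 k * v.1 j)
        - (-(v.1 j * (sin W.κ * W.netCur₁ v k + cos W.κ * W.netCur₂ v k))
          + v.2 j * (cos W.κ * W.netCur₁ v k - sin W.κ * W.netCur₂ v k))) := by
    simp only [dv₁, dv₂, Dvoc.dv₁, Dvoc.dv₂]
    simp only [show (W.unit k).η = W.η from rfl, show (W.unit k).ηa = W.ηa from rfl,
      show (W.unit k).κ = W.κ from rfl]
    ring
  rw [e, hK, hN, hφ]
  simp only [zeta]
  ring

/-! ## §4 The Lie derivatives of `ρ_k`, `ξ_kj`, `ζ_kj` (general `N`) -/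

/-- **`ρ̇_k`** (the raw product-rule expression of `hasDerivWithinAt_rho'`) in the invariants:
`2(x_k ẋ_k + y_k ẏ_k) = 2η[(P_k + η_aΦ_k) ρ_k − Σ_i (A_ki ξ_ik + B_ki ζ_ik)]` (`ζ_kk = 0`; note
`ξ_ik = ξ_ki`, `ζ_ik = −ζ_ki`). [folklore] -/
theorem lie_rho_eq (v : State N) (k : Fin N) :
    2 * (v.1 k * W.dv₁ v k + v.2 k * W.dv₂ v k)
      = 2 * W.η * ((W.ctlP k + W.ηa * (1 - rho v k / W.vref k ^ 2)) * rho v k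
          - ∑ i, (W.netA k i * xi v i k + W.netB k i * zeta v i k)) := by
  rw [W.inner_dv v k k, xi_self, zeta_self]
  ring

/-- **`ξ̇_kj`** (raw expression of `hasDerivWithinAt_xi'`) in the invariants:
`= ⟨v̂̇_k, v̂_j⟩ + ⟨v̂̇_j, v̂_k⟩` with both pairings in closed form (`inner_dv`). [folklore] -/
theorem lie_xi_eq (v : State N) (k j : Fin N) :
    W.dv₁ v k * v.1 j + v.1 k * W.dv₁ v j + (W.dv₂ v k * v.2 j + v.2 k * W.dv₂ v j)
      = W.η * ((W.ctlP k + W.ηa * (1 - rho v k / W.vref k ^ 2)) * xi v k j + W.ctlQ k * zeta v k j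
          - ∑ i, (W.netA k i * xi v i j + W.netB k i * zeta v i j))
        + W.η * ((W.ctlP j + W.ηa * (1 - rho v j / W.vref j ^ 2)) * xi v k j - W.ctlQ j * zeta v k j
          - ∑ i, (W.netA j i * xi v i k + W.netB j i * zeta v i k)) := by
  have h1 := W.inner_dv v k j
  have h2 := W.inner_dv v j k
  rw [xi_comm v k j, zeta_anticomm v k j] at h2
  linear_combination h1 + h2

/-- **`ζ̇_kj`** (raw expression of `hasDerivWithinAt_zeta'`) in the invariants:
`= ⟨J v̂̇_k, v̂_j⟩ − ⟨J v̂̇_j, v̂_k⟩` with both pairings in closed form (`innerJ_dv`). [folklore] -/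
theorem lie_zeta_eq (v : State N) (k j : Fin N) :
    W.dv₁ v k * v.2 j + v.1 k * W.dv₂ v j - (W.dv₂ v k * v.1 j + v.2 k * W.dv₁ v j)
      = W.η * ((W.ctlP k + W.ηa * (1 - rho v k / W.vref k ^ 2)) * zeta v k j - W.ctlQ k * xi v k j
          - ∑ i, (W.netA k i * zeta v i j - W.netB k i * xi v i j))
        - W.η * (-((W.ctlP j + W.ηa * (1 - rho v j / W.vref j ^ 2)) * zeta v k j) - W.ctlQ j * xi v k j
          - ∑ i, (W.netA j i * zeta v i k - W.netB j i * xi v i k)) := by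
  have h1 := W.innerJ_dv v k j
  have h2 := W.innerJ_dv v j k
  rw [xi_comm v k j, zeta_anticomm v k j] at h2
  linear_combination h1 - h2

/-! ## §5 Along solutions: every invariant coordinate obeys its quotient equation (general `N`) -/

variable {γ : ℝ → State N} {s : Set ℝ} {t : ℝ}

/-- Along a network solution, `ρ_k` obeys the degree-2 quotient equation of `lie_rho_eq`. -/
theorem hasDerivWithinAt_rho_eq (hγ : HasDerivWithinAt γ (W.field (γ t)) s t) (k : Fin N) :
    HasDerivWithinAt (fun τ => rho (γ τ) k)
      (2 * W.η * ((W.ctlP k + W.ηa * (1 - rho (γ t) k / W.vref k ^ 2)) * rho (γ t) k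
        - ∑ i, (W.netA k i * xi (γ t) i k + W.netB k i * zeta (γ t) i k))) s t := by
  rw [← W.lie_rho_eq (γ t) k]
  exact W.hasDerivWithinAt_rho' hγ k

/-- Along a network solution, `ξ_kj` obeys the degree-2 quotient equation of `lie_xi_eq`. -/
theorem hasDerivWithinAt_xi_eq (hγ : HasDerivWithinAt γ (W.field (γ t)) s t) (k j : Fin N) :
    HasDerivWithinAt (fun τ => xi (γ τ) k j)
      (W.η * ((W.ctlP k + W.ηa * (1 - rho (γ t) k / W.vref k ^ 2)) * xi (γ t) k j
          + W.ctlQ k * zeta (γ t) k j - ∑ i, (W.netA k i * xi (γ t) i j + W.netB k i * zeta (γ t) i j))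
        + W.η * ((W.ctlP j + W.ηa * (1 - rho (γ t) j / W.vref j ^ 2)) * xi (γ t) k j
          - W.ctlQ j * zeta (γ t) k j - ∑ i, (W.netA j i * xi (γ t) i k + W.netB j i * zeta (γ t) i k)))
      s t := by
  rw [← W.lie_xi_eq (γ t) k j]
  exact W.hasDerivWithinAt_xi' hγ k j

/-- Along a network solution, `ζ_kj` obeys the degree-2 quotient equation of `lie_zeta_eq`. -/
theorem hasDerivWithinAt_zeta_eq (hγ : HasDerivWithinAt γ (W.field (γ t)) s t) (k j : Fin N) :
    HasDerivWithinAt (fun τ => zeta (γ τ) k j)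
      (W.η * ((W.ctlP k + W.ηa * (1 - rho (γ t) k / W.vref k ^ 2)) * zeta (γ t) k j
          - W.ctlQ k * xi (γ t) k j - ∑ i, (W.netA k i * zeta (γ t) i j - W.netB k i * xi (γ t) i j))
        - W.η * (-((W.ctlP j + W.ηa * (1 - rho (γ t) j / W.vref j ^ 2)) * zeta (γ t) k j)
          - W.ctlQ j * xi (γ t) k j - ∑ i, (W.netA j i * zeta (γ t) i k - W.netB j i * xi (γ t) i k)))
      s t := by
  rw [← W.lie_zeta_eq (γ t) k j]
  exact W.hasDerivWithinAt_zeta' hγ k j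

end Summit.Ventures.GridStability.Models.InverterDVOC.DvocNetwork

end
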